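import Literature.NumberTheory.EllipticCurves.PeriodIndexDecompositionIndex
import Literature.NumberTheory.EllipticCurves.PeriodIndexRationalDivisor
import HarnessLib

/-!
# The index `P²` of a class of `H¹(K, E)` from local data at one decomposition group
# (Clark–Sharif 2010, §3.6: the global bookkeeping)

Topic `NumberTheory/EllipticCurves`; theorems only. Sequel of `PeriodIndexTwistedOrbitSums`
(abstract theorem) and `PeriodIndexDecompositionIndex` (its instance at `D_𝔓 ≤ Γ_K`) in the
inline proof programme of `Literature.NumberTheory.EllipticCurves.ClarkSharif2010_thm2`
(Clark–Sharif, *Period, index and potential Ш*, ANT 4 (2010), Theorem 2).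

**Main theorem** (`index_eq_sq_of_decompositionData`). Let `η = [ξ] ∈ H¹(K, E)` be the class of
a continuous crossed homomorphism `ξ : Γ_K → E(K̄)` with `P ξ = 0`, and suppose that at one
decomposition group `D_𝔓` (good place `v ∤ P`, Frobenius `φ`) the data of
`sq_dvd_card_of_twistInvariant_decompositionSubgroup` are given, with `ξ|_{D_𝔓} = χ₁ T₁ + χ₂ T₂`,
together with the Galois form of Clark–Sharif's condition (SC2′): *every `Γ_K`-invariant point
of `E(K̄)` is `P y` for some `D_𝔓`-invariant `y`* ("all elements of `E(K)` are `P`-divisible in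
`E(K_ṽ)`"). Then `I(η) = P²`.

Proof (Clark–Sharif §1.1 "the index is the least degree of a `K`-rational divisor" made
cocycle-level, cf. `PeriodIndexRationalDivisor`). `I ∣ P²` is the tree's
`index_dvd_sq_of_zsmul_eq_zero`. Conversely let `M/K` split `η`. By
`exists_intermediateField_fixingSubgroup_le_range_resGal` (`PeriodIndexCassels`) there is
`F ⊂ K̄` with `[F : K] = [M : K]` and `Γ_F` inside the image of `Γ_M`, so
(`oneCocycleClass_mem_resKer_iff`) `ξ(n) = n m - m` on `Γ_F`: the point `R = -m` of the torsor is
fixed by `Γ_F` for the twisted action `σ ⋆ Q = σ Q + ξ(σ)`. Its trace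
`D = ∑_{q ∈ Γ_K/Γ_F} [q.out ⋆ R]` is a twist-invariant multiset of cardinality `[M : K]` whose
sum `s` satisfies `τ s + [M:K] ξ(τ) = s`. By `dvd_card_of_twistInvariant_decompositionSubgroup`,
`P ∣ [M : K]`, so `s` is `Γ_K`-invariant, hence `s = P y` with `y` fixed by `D_𝔓` (SC2′), and
`sq_dvd_card_of_twistInvariant_decompositionSubgroup` gives `P² ∣ [M : K]`. As every common
divisor of the splitting degrees divides the index (`dvd_index_of_forall_dvd`), `P² ∣ I(η)`.

## References

* P. L. Clark, S. Sharif, *Period, index and potential Ш*, Algebra & Number Theory 4 (2010)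
  151–174, §1.1 and §3.6 (`ClarkSharif2010`; arXiv:0811.3019 read).
* J.-P. Serre, *Galois Cohomology* (1997), I.§5 (twisting, torsors) (`SerreGaloisCohomology1997`).
-/

noncomputable section

open scoped Classical Pointwise
open NumberField IsDedekindDomain Field
open Literature.NumberTheory.GaloisRepresentations IsDedekindDomain.HeightOneSpectrum

universe u

namespace Literature.NumberTheory.EllipticCurves

variable {K : Type u} [Field K]

/-- **The trace of a torsor point is a rational divisor.** For a continuous crossed homomorphism
`c : Γ_K → E(K̄)`, a subgroup `N ≤ Γ_K` of finite index and a point `R` fixed by `N` for the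
twisted action `σ ⋆ Q = σ Q + c(σ)`, the multiset `D = ∑_{q ∈ Γ_K/N} [q.out ⋆ R]` has
cardinality `[Γ_K : N]`, is invariant under the twisted action (in the form
`count (g ⋆ x) D = count x D`), and its sum `s` satisfies `g s + [Γ_K : N] c(g) = s`.
Silverman, *AEC*, X.§3 (torsors); Clark–Sharif §1.1 (rational divisors on the torsor).
[folklore] -/
theorem trace_twistInvariant (W : WeierstrassCurve K)
    (c : contOneCocycles (discreteTopRep (absoluteGaloisGroup K) (WeierstrassCurve.geomPoints W)))
    (N : Subgroup (absoluteGaloisGroup K)) [Fintype (absoluteGaloisGroup K ⧸ N)]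
    {R : WeierstrassCurve.geomPoints W} (hR : ∀ n ∈ N, n • R + c.1 n = R) :
    Multiset.card ((Finset.univ : Finset (absoluteGaloisGroup K ⧸ N)).val.map
        fun q ↦ q.out • R + c.1 q.out) = N.index ∧
      (∀ (g : absoluteGaloisGroup K) (x : WeierstrassCurve.geomPoints W),
        ((Finset.univ : Finset (absoluteGaloisGroup K ⧸ N)).val.map
          fun q ↦ q.out • R + c.1 q.out).count (g • x + c.1 g) =
        ((Finset.univ : Finset (absoluteGaloisGroup K ⧸ N)).val.map
          fun q ↦ q.out • R + c.1 q.out).count x) ∧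
      ∀ g : absoluteGaloisGroup K,
        g • ((Finset.univ : Finset (absoluteGaloisGroup K ⧸ N)).val.map
            fun q ↦ q.out • R + c.1 q.out).sum +
          N.index • c.1 g =
        ((Finset.univ : Finset (absoluteGaloisGroup K ⧸ N)).val.map
            fun q ↦ q.out • R + c.1 q.out).sum := by
  set f : absoluteGaloisGroup K → WeierstrassCurve.geomPoints W := fun g ↦ g • R + c.1 g with hf
  have hfN : ∀ g, ∀ n ∈ N, f (g * n) = f g := fun g n hn ↦ by
    simp only [hf]
    rw [twist_mul W c, hR n hn]
  have hout : ∀ g : absoluteGaloisGroup K, f ((g : absoluteGaloisGroup K ⧸ N).out) = f g := fun g ↦ by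
    obtain ⟨n, hn⟩ := QuotientGroup.mk_out_eq_mul N g
    rw [hn, hfN g n n.2]
  set D : Multiset (WeierstrassCurve.geomPoints W) :=
    (Finset.univ : Finset (absoluteGaloisGroup K ⧸ N)).val.map fun q ↦ f q.out with hD
  have hcard : Multiset.card D = N.index := by
    rw [hD, Multiset.card_map, Finset.card_val, Finset.card_univ, Subgroup.index_eq_card,
      Nat.card_eq_fintype_card]
  -- invariance of the multiset
  have hmap : ∀ g : absoluteGaloisGroup K, D.map (fun x ↦ g • x + c.1 g) = D := by
    intro g
    rw [hD, Multiset.map_map]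
    have e : ((fun x ↦ g • x + c.1 g) ∘ fun q : absoluteGaloisGroup K ⧸ N ↦ f q.out) =
        (fun q : absoluteGaloisGroup K ⧸ N ↦ f q.out) ∘ (MulAction.toPerm g) := by
      ext q
      simp only [Function.comp_apply, MulAction.toPerm_apply, hf]
      rw [← twist_mul W c, ← MulAction.Quotient.coe_smul_out, smul_eq_mul]
      exact (hout (g * q.out)).symm
    rw [e, ← Multiset.map_map, Multiset.map_univ_val_equiv]
  refine ⟨hcard, fun g x ↦ ?_, fun g ↦ ?_⟩
  · conv_lhs => rw [← hmap g]
    exact Multiset.count_map_eq_count' _ _ (twist_injective W c g) x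
  · have h1 := congrArg Multiset.sum (hmap g)
    rw [Multiset.sum_map_add, Multiset.map_const', Multiset.sum_replicate, ← Multiset.smul_sum,
      hcard] at h1
    exact h1

/-- **The index of a class is `P²` from local data at one decomposition group** (Clark–Sharif
2010, proof of Theorem 2, §3.6: "`I(C) = P²`"). Let `E/K` be an elliptic curve over a number
field, `ξ : Γ_K → E(K̄)` a continuous crossed homomorphism with `P ξ = 0` and class `η`, `v ∤ P`
a good place, `𝔓 ∣ v` with decomposition group `D_𝔓`, inertia `I_𝔓`, Frobenius `φ`. Assume the
data of `sq_dvd_card_of_twistInvariant_decompositionSubgroup` (`T₁, T₂`, `χ₁, χ₂`, the nice-point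
supply) with `ξ|_{D_𝔓} = χ₁ T₁ + χ₂ T₂`, and (SC2′) in Galois form: every `Γ_K`-invariant point is
`P y` with `y` fixed by `D_𝔓`. Then `index W η = P²`. [cite: ClarkSharif2010, §3.6] -/
theorem index_eq_sq_of_decompositionData [NumberField K] (W : WeierstrassCurve K) [W.IsElliptic]
    {P : ℕ} [NeZero P] {v : HeightOneSpectrum (𝓞 K)} (hv : W.HasGoodReductionAt v)
    (hvP : ((P : ℕ) : 𝓞 K) ∉ v.asIdeal)
    {𝔓 : Ideal (absIntegers (𝓞 K) K)} (h𝔓 : 𝔓 ∈ v.primesAbove)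
    {φ : absoluteGaloisGroup K} (hφ : IsArithFrobAt (𝓞 K) φ 𝔓)
    (ξ : contOneCocycles (discreteTopRep (absoluteGaloisGroup K) (WeierstrassCurve.geomPoints W)))
    (hξP : ∀ σ : absoluteGaloisGroup K, P • ξ.1 σ = 0)
    {T₁ T₂ : WeierstrassCurve.geomPoints W} (hT₁ : P • T₁ = 0) (hT₂ : P • T₂ = 0)
    (hindep : ∀ m n : ℤ, m • T₁ + n • T₂ = 0 → (P : ℤ) ∣ m ∧ (P : ℤ) ∣ n)
    (hfix : ∀ a : WeierstrassCurve.geomPoints W, P • a = 0 →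
      ∀ σ ∈ 𝔓.decompositionSubgroup (absoluteGaloisGroup K), σ • a = a)
    (hjunk : ∃ c : WeierstrassCurve.geomPoints W,
      (∀ σ ∈ 𝔓.decompositionSubgroup (absoluteGaloisGroup K), σ • c = c) ∧
        P • c = (P * (P - 1) / 2) • T₁)
    (χ₁ χ₂ : ↥(𝔓.decompositionSubgroup (absoluteGaloisGroup K)) → ZMod P)
    (hχ₁ : ∀ σ τ, χ₁ (σ * τ) = χ₁ σ + χ₁ τ) (hχ₂ : ∀ σ τ, χ₂ (σ * τ) = χ₂ σ + χ₂ τ)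
    (hχ₁c : IsOpen {σ : ↥(𝔓.decompositionSubgroup (absoluteGaloisGroup K)) | χ₁ σ = 0})
    (hχ₂c : IsOpen {σ : ↥(𝔓.decompositionSubgroup (absoluteGaloisGroup K)) | χ₂ σ = 0})
    (hIχ₁ : ∀ c : ZMod P, ∃ σ : ↥(𝔓.decompositionSubgroup (absoluteGaloisGroup K)),
      (σ : absoluteGaloisGroup K) ∈ 𝔓.inertia (absoluteGaloisGroup K) ∧ χ₁ σ = c)
    (hIχ₂ : ∀ σ : ↥(𝔓.decompositionSubgroup (absoluteGaloisGroup K)),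
      (σ : absoluteGaloisGroup K) ∈ 𝔓.inertia (absoluteGaloisGroup K) → χ₂ σ = 0)
    (hF : IsUnit (χ₂ ⟨φ, by haveI : 𝔓.IsPrime := h𝔓.1; exact hφ.mem_stabilizer⟩))
    (hnice : ∀ f : ℕ, 0 < f → ∀ a : WeierstrassCurve.geomPoints W, P • a = 0 →
      ∃ z : WeierstrassCurve.geomPoints W,
        (∀ σ ∈ 𝔓.inertia (absoluteGaloisGroup K), σ • z = z) ∧ φ ^ f • z - z = a)
    (hshape : ∀ σ : ↥(𝔓.decompositionSubgroup (absoluteGaloisGroup K)),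
      ξ.1 σ = (χ₁ σ).val • T₁ + (χ₂ σ).val • T₂)
    (hSC2 : ∀ s : WeierstrassCurve.geomPoints W, (∀ σ : absoluteGaloisGroup K, σ • s = s) →
      ∃ y : WeierstrassCurve.geomPoints W,
        (∀ σ ∈ 𝔓.decompositionSubgroup (absoluteGaloisGroup K), σ • y = y) ∧ P • y = s) :
    index W (oneCocycleClass _ ξ) = P ^ 2 := by
  haveI : IsGalois K (AlgebraicClosure K) := {}
  set η : W.galH1 := oneCocycleClass _ ξ with hη
  -- `I ∣ P²`
  have hPη : P • η = 0 := by
    have h := oneCocycleClass_smul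
      (discreteTopRep (absoluteGaloisGroup K) (WeierstrassCurve.geomPoints W)) (P : ℤ) ξ
    conv at h => rhs; rw [Nat.cast_smul_eq_nsmul]
    rw [hη, ← h]
    have h0 : ((P : ℤ) • ξ) = 0 := by
      apply Subtype.ext
      ext σ
      change (P : ℤ) • ξ.1 σ = 0
      rw [natCast_zsmul, hξP]
    rw [h0, oneCocycleClass_zero]
  have hdvd : index W η ∣ P ^ 2 :=
    index_dvd_sq_of_zsmul_eq_zero W (n := P) (by exact_mod_cast NeZero.ne P)
      (by rw [natCast_zsmul]; exact hPη)
  -- `P² ∣` every splitting degree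
  have hkey : ∀ d ∈ splittingDegrees W η, P ^ 2 ∣ d := by
    rintro d ⟨M, _, _, _, rfl, hηM⟩
    obtain ⟨F, hFfd, hrank, hle⟩ :=
      exists_intermediateField_fixingSubgroup_le_range_resGal (K := K) M
    haveI := hFfd
    set N : Subgroup (absoluteGaloisGroup K) := F.fixingSubgroup with hNdef
    have hidx : N.index = Module.finrank K M := by
      rw [← hrank]
      exact (IntermediateField.finrank_eq_fixingSubgroup_index F).symm
    haveI : N.FiniteIndex := ⟨by rw [hidx]; exact Module.finrank_pos.ne'⟩
    letI : Fintype (absoluteGaloisGroup K ⧸ N) := Fintype.ofFinite _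
    -- a point of the torsor fixed by `Γ_F`
    obtain ⟨a, ha⟩ :=
      (oneCocycleClass_mem_resKer_iff (resGal (K := K) M) (pointsMap W M) (pointsMap_smul W M) ξ).mp hηM
    obtain ⟨m, hm⟩ := (pointsMapOfEmb_bijective M W (closureEmb (K := K) M)).2 a
    have hNm : ∀ n ∈ N, ξ.1 n = n • m - m := by
      intro n hn
      obtain ⟨x, rfl⟩ := hle hn
      apply (pointsMapOfEmb_bijective M W (closureEmb (K := K) M)).1
      change pointsMap W M (ξ.1 (resGal (K := K) M x)) = pointsMap W M (resGal (K := K) M x • m - m)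
      rw [map_sub, pointsMap_smul, ha x, ← hm]
      rfl
    have hR : ∀ n ∈ N, n • (-m) + ξ.1 n = -m := fun n hn ↦ by
      rw [hNm n hn, smul_neg]
      abel
    obtain ⟨hcard, hcount, hsum⟩ := trace_twistInvariant W ξ N hR
    set D : Multiset (WeierstrassCurve.geomPoints W) :=
      (Finset.univ : Finset (absoluteGaloisGroup K ⧸ N)).val.map fun q ↦ q.out • (-m) + ξ.1 q.out
      with hDdef
    rw [hidx] at hcard hsum
    -- invariance under the decomposition group, in the `χ`-shape
    have hD : ∀ (σ : ↥(𝔓.decompositionSubgroup (absoluteGaloisGroup K)))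
        (x : WeierstrassCurve.geomPoints W),
        D.count ((σ : absoluteGaloisGroup K) • x + ((χ₁ σ).val • T₁ + (χ₂ σ).val • T₂)) = D.count x := by
      intro σ x
      rw [← hshape σ]
      exact hcount σ x
    -- `P ∣ [M : K]`, so the sum is `Γ_K`-invariant
    have hPd : P ∣ Module.finrank K M := by
      rw [← hcard]
      exact dvd_card_of_twistInvariant_decompositionSubgroup W hv hvP h𝔓 hφ hT₁ hT₂ hindep hfix
        hjunk χ₁ χ₂ hχ₁ hχ₂ hχ₁c hχ₂c hIχ₁ hIχ₂ hnice D hD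
    have hsfix : ∀ σ : absoluteGaloisGroup K, σ • D.sum = D.sum := by
      intro σ
      have h1 := hsum σ
      obtain ⟨k, hk⟩ := hPd
      rw [hk, mul_nsmul, hξP σ, nsmul_zero, add_zero] at h1
      exact h1
    obtain ⟨y, hyfix, hy⟩ := hSC2 D.sum hsfix
    rw [← hcard]
    exact sq_dvd_card_of_twistInvariant_decompositionSubgroup W hv hvP h𝔓 hφ hT₁ hT₂ hindep hfix
      hjunk χ₁ χ₂ hχ₁ hχ₂ hχ₁c hχ₂c hIχ₁ hIχ₂ hF hnice D hD ⟨y, hyfix, hy.symm⟩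
  exact Nat.dvd_antisymm hdvd (dvd_index_of_forall_dvd W (splittingDegrees_nonempty W η) hkey)

end Literature.NumberTheory.EllipticCurves
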